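import Summits.Ventures.HodgeRepro2.T6Host
import Summits.Ventures.HodgeRepro2.T6HostLemmas
import Summits.Ventures.HodgeRepro2.T6HostHodge
import Summits.Ventures.HodgeRepro2.T6A1DictFactors
import Summits.Ventures.HodgeRepro2.T6A1DictFactors2
import Summits.Ventures.HodgeRepro2.T6A1DictHodge2
import Summits.Ventures.HodgeRepro2.T6A1BaseChange
import Summits.Ventures.HodgeRepro2.T6TheoremA

/-!
# T6A1HostBetti — the A1 dictionary with Hodge types on the (S4) object, Hodge side read from `BettiHodgeData`
(TARGET-T6.md §2 Layer III; the lead's rulings STATUS ll. 5320 / 10912; owner t6-p1, gen 2)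

CARRIER: `HC X 1 = ℂ ⊗[ℚ] H¹(X(ℂ), ℚ)` (T6Host v3's own: `CornerProduct.act`, `eig`, `weilC`,
`pull_internal`, `pull_injective`, `CMVariety.finrank_eig` all live there). The HODGE PIECES are read from
a `Bd : BettiHodgeData ℂ` (the host's Weil-cohomology datum with Hodge structures) and transported ONCE
along `Bd.isoObj` (`hodgeHC`). THE CONSTRUCTOR `factorIdentHC Bd C hT hcA hcB h17` builds the dictionary
with Hodge types (`T6A1DictHodge.FactorIdent`) of the corner product `C` from EXPLICIT binders — exactly the
facts the lead's `T6HostBetti` (clause (a): the pieces of `Bd` are the host's `hodgePart`) supplies: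
`hT` (the CM type of each factor is read off the `(1,0)`-piece: `σ ∈ T i ↔ H¹_σ(A_i) ≤ H^{1,0}(A_i)`),
`hcA` / `hcB` (`H¹ = H^{1,0} ⊕ H^{0,1}` for the factors and for `B`) and the dimension display
`h17` (Lange–Birkenhake Lemma 1.1.17 on the rational Betti cohomology). EVERYTHING ELSE IS DERIVED: the
splitting `H¹(B) = ⊕ pr_i^* H¹(A_i)` after base change (`isInternal_baseChange`, a generic lemma), the
`K`-equivariance of `pr_i^*` (`T6HostLemmas.act_pull`), the eigenlines (`finrank_eig`), the Hodge
functoriality (`Bd.pullback_hom` through `HodgeStructure.Hom.map_piece_le`: the `K`-action on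
`H¹(A_i)` and the projections `pr_i^*` respect the `(1,0)`- and `(0,1)`-pieces), the canonical rational
structure of `ℂ ⊗[ℚ] Q` (`ratHC`, no display) and its compatibility with pull-backs. Outputs:
`FactorIdent` (hence `phi`, `phi_act`, `map_h10`, `map_h01`, `ratl1_iff`, `identOfFactors`), the numerology
`finrank_eig`, `finrank_eig_h10` (`T6A1DictFactors2`), and `alg_lefschetz_HC` = `TransferShadow.alg_lefschetz`
on the host from Lefschetz (1,1) in the `Bd`-vocabulary (the binder `hLef`, t6-p2's display) through
`T6A1DictHodge2.alg_lefschetz_of`. §8(d): uses an L-value-free non-vanishing device: NO.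
-/

noncomputable section

open CategoryTheory
open scoped TensorProduct
open HostAPI.Carriers.AlgebraicGeometry.Motives HostAPI.Carriers.AlgebraicGeometry.HodgeTheory

namespace Summit.Ventures.HodgeRepro2.T6.A1HostBetti

open Host A1Dict A1DictRat A1DictHodge A1DictFactors A1DictFactors2 A1BaseChange

/-! ## 3. The Hodge pieces of `Bd` on the rational Betti cohomology; Hodge functoriality -/

section hodge

/-- A morphism of Hodge structures maps the `(p,q)`-piece into the `(p,q)`-piece (its base change commutes
with the complex conjugation, `HodgeStructure.conj_baseChange`). -/
theorem _root_.HostAPI.Carriers.AlgebraicGeometry.Motives.HodgeStructure.Hom.map_piece_le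
    {V W : Type} [AddCommGroup V] [Module ℚ V] [AddCommGroup W] [Module ℚ W] {n : ℤ}
    {H₁ : HodgeStructure V n} {H₂ : HodgeStructure W n} (φ : HodgeStructure.Hom H₁ H₂) (p q : ℤ) :
    (H₁.piece p q).map (φ.toLinearMap.baseChange ℂ) ≤ H₂.piece p q := by
  unfold HodgeStructure.piece
  split_ifs with h
  · intro y hy
    obtain ⟨x, hx, rfl⟩ := Submodule.mem_map.1 hy
    obtain ⟨hx1, hx2⟩ := Submodule.mem_inf.1 hx
    refine Submodule.mem_inf.2 ⟨φ.map_F_le p (Submodule.mem_map_of_mem hx1), ?_⟩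
    rw [HodgeStructure.mem_complexConj] at hx2 ⊢
    rw [HodgeStructure.conj_baseChange]
    exact φ.map_F_le q (Submodule.mem_map_of_mem hx2)
  · rw [Submodule.map_bot]

variable (Bd : BettiHodgeData ℂ)

-- `isoC Bd X k` / `hodgeHC Bd hX k p q` are the lead's `T6HostHodge` definitions (moved there verbatim from this
-- file, STATUS l. 11045 (1)); `open Host` supplies them.

/-- `isoObj` intertwines the pull-backs (`BettiHodgeData.isoObj_pullback`, as an equation of maps). -/
theorem pullQ_comp_isoObj {X Y : SchemeOver ℂ} (f : X ⟶ Y) (k : ℕ) :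
    pullQ f k ∘ₗ (Bd.isoObj Y k).toLinearMap = (Bd.isoObj X k).toLinearMap ∘ₗ Bd.W.pullback f k := by
  ext a
  exact (Bd.isoObj_pullback f k a).symm

/-- The base change of `pullQ f k` intertwines the `isoC`. -/
theorem baseChange_pullQ_comp_isoC {X Y : SchemeOver ℂ} (f : X ⟶ Y) (k : ℕ) :
    (pullQ f k).baseChange ℂ ∘ₗ (isoC Bd Y k).toLinearMap =
      (isoC Bd X k).toLinearMap ∘ₗ (Bd.W.pullback f k).baseChange ℂ := by
  rw [LinearEquiv.coe_baseChange, LinearEquiv.coe_baseChange, ← LinearMap.baseChange_comp,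
    ← LinearMap.baseChange_comp, pullQ_comp_isoObj]

/-- HODGE FUNCTORIALITY ON THE HOST: the pull-back `f^* ⊗ 1` along a morphism of smooth projective varieties
sends the `(p,q)`-piece of `Y` into the `(p,q)`-piece of `X` (`Bd.pullback_hom` + `map_piece_le`). -/
theorem map_hodgeHC_le {n m : ℕ} {X Y : SchemeOver ℂ} (hX : IsSmoothProjective n X)
    (hY : IsSmoothProjective m Y) (f : X ⟶ Y) (k : ℕ) (p q : ℤ) :
    (hodgeHC Bd hY k p q).map ((pullQ f k).baseChange ℂ) ≤ hodgeHC Bd hX k p q := by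
  obtain ⟨φ, hφ⟩ := Bd.pullback_hom hX hY f k
  unfold hodgeHC
  rw [← Submodule.map_comp, baseChange_pullQ_comp_isoC, Submodule.map_comp]
  refine Submodule.map_mono ?_
  rw [← hφ]
  exact φ.map_piece_le p q

end hodge

/-! ## 4. The factor data of the corner product -/

section factors

variable {K : Type} [Field K] [NumberField K] [NumberField.IsCMField K] (Bd : BettiHodgeData ℂ)
  (C : CornerProduct K)

/-- `pr_i^* ⊗ 1 : ℂ ⊗ H¹(A_i(ℂ), ℚ) → ℂ ⊗ H¹(B(ℂ), ℚ)`. -/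
abbrev pullC (i : Fin 4) : HC (C.A i).A.X 1 →ₗ[ℂ] HC C.B.X 1 := (avPullQ (C.pr i) 1).baseChange ℂ

/-- `pr_i^* ⊗ 1` intertwines the complexified `K`-actions (`T6HostLemmas.act_pull`). -/
theorem pullC_act (i : Fin 4) (x : K) (v : HC (C.A i).A.X 1) :
    baseChangeAct C.act x (pullC C i v) = pullC C i (baseChangeAct (C.A i).act x v) := by
  have h := congrArg (fun g => g.baseChange ℂ) (C.act_pull i x)
  simp only [LinearMap.baseChange_comp] at h
  exact LinearMap.congr_fun h v

/-- The complexified action of a CM factor preserves the Hodge pieces (`act_endo` on the order, clearing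
denominators on `K`, Hodge functoriality along the endomorphisms). -/
theorem act_mem_hodgeHC (A : CMVariety K) (x : K) (p q : ℤ) :
    ∀ v ∈ hodgeHC Bd A.smooth 1 p q, baseChangeAct A.act x v ∈ hodgeHC Bd A.smooth 1 p q := by
  -- on the order
  have hO : ∀ y : A.O', ∀ v ∈ hodgeHC Bd A.smooth 1 p q, baseChangeAct A.act y v ∈ hodgeHC Bd A.smooth 1 p q := by
    intro y v hv
    have : baseChangeAct A.act y = (avPullQ (A.endo y) 1).baseChange ℂ := by
      show (A.act y).baseChange ℂ = _
      rw [A.act_endo y]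
    rw [this]
    exact map_hodgeHC_le Bd A.smooth A.smooth (avHom (A.endo y)) 1 p q (Submodule.mem_map_of_mem hv)
  intro v hv
  obtain ⟨n, hn, hnx⟩ := A.exists_natCast_mul_mem x
  have h1 := hO ⟨(n : K) * x, hnx⟩ v hv
  have h2 : baseChangeAct A.act ((n : K) * x) v = (n : ℂ) • baseChangeAct A.act x v := by
    rw [map_mul, map_natCast, Module.End.mul_apply, Module.End.natCast_apply, ← Nat.cast_smul_eq_nsmul ℂ]
  rw [h2] at h1
  have hn' : (n : ℂ) ≠ 0 := by exact_mod_cast hn.ne'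
  have := (hodgeHC Bd A.smooth 1 p q).smul_mem (n : ℂ)⁻¹ h1
  rwa [smul_smul, inv_mul_cancel₀ hn', one_smul] at this

/-- `pr_i^* ⊗ 1` respects the Hodge pieces. -/
theorem pullC_hodgeHC_le (i : Fin 4) (p q : ℤ) :
    (hodgeHC Bd (C.A i).smooth 1 p q).map (pullC C i) ≤ hodgeHC Bd C.smooth 1 p q :=
  map_hodgeHC_le Bd C.smooth (C.A i).smooth (avHom (C.pr i)) 1 p q

/-- `pr_i^* ⊗ 1` preserves rational classes. -/
theorem pullC_ratC (i : Fin 4) : ∀ r ∈ (ratC : Submodule ℚ (HC (C.A i).A.X 1)), pullC C i r ∈ ratC :=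
  fun _ hr => baseChange_mem_ratC _ hr

/-- [display, t6-p1's `T6A1HypHost` v2 — stated here as a binder only] `dim_ℚ H¹(A(ℂ), ℚ) = 2 · dim A` for
a complex abelian variety (Lange–Birkenhake Lemma 1.1.17: `H¹(X, ℤ) = Hom(Λ, ℤ)`, a lattice of rank `2g`). -/
abbrev Lemma1117Q : Prop :=
  ∀ A : AbelianVariety ℂ, IsSmoothProjective A.dim A.X → Module.finrank ℚ (HQ A.X 1) = 2 * A.dim

/-- THE FACTOR DATA OF THE CORNER PRODUCT on `HC = ℂ ⊗ H¹(·, ℚ)`, with the Hodge pieces of `Bd`: from the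
binders `hT` (the CM types read off the `(1,0)`-pieces), `hcA` / `hcB` (`H¹ = H^{1,0} ⊕ H^{0,1}`) and `h17`
(the dimension display); everything else derived from the v3 fields and `Bd.pullback_hom`. -/
def factorDataHC (hT : ∀ (i : Fin 4) (σ : K →+* ℂ), σ ∈ C.F.T i ↔
      eigC (C.A i).act σ ≤ hodgeHC Bd (C.A i).smooth 1 1 0)
    (hcA : ∀ i, IsCompl (hodgeHC Bd (C.A i).smooth 1 1 0) (hodgeHC Bd (C.A i).smooth 1 0 1))
    (hcB : IsCompl (hodgeHC Bd C.smooth 1 1 0) (hodgeHC Bd C.smooth 1 0 1)) (h17 : Lemma1117Q) :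
    FactorData C.F (baseChangeAct C.act) (hodgeHC Bd C.smooth 1 1 0) (hodgeHC Bd C.smooth 1 0 1)
      (pullC C) (fun i => baseChangeAct (C.A i).act) (fun i => hodgeHC Bd (C.A i).smooth 1 1 0)
      (fun i => hodgeHC Bd (C.A i).smooth 1 0 1) where
  isInternal := isInternal_baseChange _ C.pull_internal
  ι_act := pullC_act C
  finrank_V := by rw [Module.finrank_baseChange, h17 C.B C.smooth, C.dim_eq]
  finrank_Vf i := by rw [Module.finrank_baseChange, h17 (C.A i).A (C.A i).smooth, C.dim_factor i]
  line i τ := (C.A i).finrank_eig τ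
  compl_f := hcA
  act_h10f i x := act_mem_hodgeHC Bd (C.A i) x 1 0
  act_h01f i x := act_mem_hodgeHC Bd (C.A i) x 0 1
  type_spec i τ := (hT i τ).symm
  ι_h10 i := pullC_hodgeHC_le Bd C i 1 0
  ι_h01 i := pullC_hodgeHC_le Bd C i 0 1
  compl_V := hcB
  rsf i := ratHC (C.A i).act
  rsV := ratHC C.act
  ι_ratl := pullC_ratC C

/-- THE FACTOR IDENTIFICATION OF THE CORNER PRODUCT (`T6A1DictHodge.FactorIdent`) on the host, rational
classes `= ratC` (the range of `q ↦ 1 ⊗ q`). -/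
def factorIdentHC (hT : ∀ (i : Fin 4) (σ : K →+* ℂ), σ ∈ C.F.T i ↔
      eigC (C.A i).act σ ≤ hodgeHC Bd (C.A i).smooth 1 1 0)
    (hcA : ∀ i, IsCompl (hodgeHC Bd (C.A i).smooth 1 1 0) (hodgeHC Bd (C.A i).smooth 1 0 1))
    (hcB : IsCompl (hodgeHC Bd C.smooth 1 1 0) (hodgeHC Bd C.smooth 1 0 1)) (h17 : Lemma1117Q) :
    FactorIdent C.F (baseChangeAct C.act) (hodgeHC Bd C.smooth 1 1 0) (hodgeHC Bd C.smooth 1 0 1)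
      (· ∈ (ratC : Submodule ℚ (HC C.B.X 1))) :=
  (factorDataHC Bd C hT hcA hcB h17).factorIdent

/-- **`dim H¹_σ(B) = 4`** on the (S4) object (the numerology-era field, a theorem of v3). -/
theorem finrank_eig (hT : ∀ (i : Fin 4) (σ : K →+* ℂ), σ ∈ C.F.T i ↔
      eigC (C.A i).act σ ≤ hodgeHC Bd (C.A i).smooth 1 1 0)
    (hcA : ∀ i, IsCompl (hodgeHC Bd (C.A i).smooth 1 1 0) (hodgeHC Bd (C.A i).smooth 1 0 1))
    (hcB : IsCompl (hodgeHC Bd C.smooth 1 1 0) (hodgeHC Bd C.smooth 1 0 1)) (h17 : Lemma1117Q)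
    (σ : K →+* ℂ) : Module.finrank ℂ (C.eig σ) = 4 :=
  finrank_eigSub (factorDataHC Bd C hT hcA hcB h17) σ

/-- **`dim (H¹_σ(B) ∩ H^{1,0}(B)) = #{i | σ ∈ T i}`** on the (S4) object. -/
theorem finrank_eig_h10 (hT : ∀ (i : Fin 4) (σ : K →+* ℂ), σ ∈ C.F.T i ↔
      eigC (C.A i).act σ ≤ hodgeHC Bd (C.A i).smooth 1 1 0)
    (hcA : ∀ i, IsCompl (hodgeHC Bd (C.A i).smooth 1 1 0) (hodgeHC Bd (C.A i).smooth 1 0 1))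
    (hcB : IsCompl (hodgeHC Bd C.smooth 1 1 0) (hodgeHC Bd C.smooth 1 0 1)) (h17 : Lemma1117Q)
    (σ : K →+* ℂ) :
    Module.finrank ℂ ↥(C.eig σ ⊓ hodgeHC Bd C.smooth 1 1 0) = Nat.card {i : Fin 4 // σ ∈ C.F.T i} :=
  finrank_eigSub_inf_h10V (factorDataHC Bd C hT hcA hcB h17) σ

end factors

/-! ## 5. Lefschetz (1,1) on the host through the degree-2 dictionary -/

section lefschetz

variable {K : Type} [Field K] [NumberField K] [NumberField.IsCMField K] (Bd : BettiHodgeData ℂ)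
  (C : CornerProduct K)

/-- The cup product of two rational classes is rational (`cupC11` is the base change of `cupQ`). -/
theorem cupC11_mem_ratC {a b : HC C.B.X 1} (ha : a ∈ (ratC : Submodule ℚ (HC C.B.X 1)))
    (hb : b ∈ (ratC : Submodule ℚ (HC C.B.X 1))) : cupC11 C.B.X a b ∈ (ratC : Submodule ℚ (HC C.B.X 2)) := by
  obtain ⟨a, rfl⟩ := ha
  obtain ⟨b, rfl⟩ := hb
  refine ⟨cupQ (rfl : 1 + 1 = 2) a b, ?_⟩
  simp only [TensorProduct.mk_apply, cupC11, LinearMap.BilinMap.baseChange_tmul, one_mul]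

/-- The `(1,1)`-clause of Lange–Birkenhake Thm 1.1.21 in the display's shape (`T6A1HypHost.
LangeBirkenhake1992_Thm1_1_21_Betti Bd` at `B`) gives the `hspan` binder of `alg_lefschetz_HC`. -/
theorem span11_le_of_eq
    (h : hodgeHC Bd C.smooth 2 1 1 = Submodule.span ℂ {w | ∃ v : Fin 2 → HC C.B.X 1,
      v 0 ∈ hodgeHC Bd C.smooth 1 1 0 ∧ v 1 ∈ hodgeHC Bd C.smooth 1 0 1 ∧ w = cupC11 C.B.X (v 0) (v 1)}) :
    A1DictHodge2.span11 (fun a b => cupC11 C.B.X a b) (hodgeHC Bd C.smooth 1 1 0)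
      (hodgeHC Bd C.smooth 1 0 1) ≤ hodgeHC Bd C.smooth 2 1 1 := by
  rw [h]
  apply Submodule.span_mono
  rintro _ ⟨a, ha, b, hb, rfl⟩
  exact ⟨![a, b], ha, hb, rfl⟩

/-- THE LEFSCHETZ (1,1) DISCHARGE ON THE HOST: a rational degree-2 class `a` of the model of Hodge type `(1,1)`
is sent by the degree-2 dictionary `lange2 phi e2` to a class of `ℂ ⊗ H²(B(ℂ), ℚ)` in the base change of the
host's `coniveau C.B.X 2 1` (the rational algebraic classes of `H²`), from Lefschetz (1,1) on the host
(`hLef` — t6-p2's `Lefschetz11_Betti Bd` through the lead's clause (b), consumed as a binder in the `HC`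
shape), Lange's `e2 : ⋀² H¹ ≃ H²` on cup products (t6-p2's Lange all-degrees at `n = 2`) and the
`(1,1)`-clause of Lange–Birkenhake Thm 1.1.21 (`hspan`) — `TransferShadow.alg_lefschetz` for
`Alg 1 := (lange2 ∘ extC)⁻¹ ((coniveau C.B.X 2 1).baseChange ℂ)`. -/
theorem alg_lefschetz_HC (hT : ∀ (i : Fin 4) (σ : K →+* ℂ), σ ∈ C.F.T i ↔
      eigC (C.A i).act σ ≤ hodgeHC Bd (C.A i).smooth 1 1 0)
    (hcA : ∀ i, IsCompl (hodgeHC Bd (C.A i).smooth 1 1 0) (hodgeHC Bd (C.A i).smooth 1 0 1))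
    (hcB : IsCompl (hodgeHC Bd C.smooth 1 1 0) (hodgeHC Bd C.smooth 1 0 1)) (h17 : Lemma1117Q)
    (hLef : ∀ c : HC C.B.X 2, c ∈ (ratC : Submodule ℚ (HC C.B.X 2)) → c ∈ hodgeHC Bd C.smooth 2 1 1 →
      c ∈ (coniveau C.B.X 2 1).baseChange ℂ)
    (hspan : A1DictHodge2.span11 (fun a b => cupC11 C.B.X a b) (hodgeHC Bd C.smooth 1 1 0)
      (hodgeHC Bd C.smooth 1 0 1) ≤
      hodgeHC Bd C.smooth 2 1 1)
    (e2 : ⋀[ℂ]^2 (HC C.B.X 1) ≃ₗ[ℂ] HC C.B.X 2)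
    (he2 : ∀ v : Fin 2 → HC C.B.X 1, e2 (exteriorPower.ιMulti ℂ 2 v) = cupC11 C.B.X (v 0) (v 1)) :
    ∀ a ∈ degB K 2, extC K a ∈ hodge C.F 1 1 →
      A1DictHodge2.lange2 ((factorIdentHC Bd C hT hcA hcB h17).phi C.F.deg6) e2 (extC K a) ∈
        (coniveau C.B.X 2 1).baseChange ℂ :=
  A1DictHodge2.alg_lefschetz_of (factorIdentHC Bd C hT hcA hcB h17) (· ∈ (ratC : Submodule ℚ (HC C.B.X 2)))
    C.F.deg6 e2 he2 (fun _ _ ha hb => cupC11_mem_ratC C ha hb) (Submodule.zero_mem _)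
    (fun _ _ ha hb => Submodule.add_mem _ ha hb) (fun q _ hc => ratSmul_mem_ratC q hc)
    (hodgeHC Bd C.smooth 2 1 1) ((coniveau C.B.X 2 1).baseChange ℂ) hspan hLef

end lefschetz

/-! ## 6. THE A1 TRANSPORT on the (S4) object: `Hyp.PeriodN D → SplitWeilAlgebraic C` -/

section transport

variable {K : Type} [Field K] [NumberField K] [NumberField.IsCMField K] (Bd : BettiHodgeData ℂ)
  (C : CornerProduct K)

/-- The lead's `weilC` is `A1Dict.weilSpan` on `HC`. -/
theorem weilC_eq : C.weilC = weilSpan (bcAct C.act) (fun a b c d => cup4C a b c d) := rfl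

/-- `SplitWeilAlgebraic C` (v3: `weilQ ≤ coniveau`) from `A1Dict.SplitWeilAlg` on `HC` with the rational
classes `ratC` and the base change of the host's `coniveau C.B.X 4 2` (`mem_baseChange_mk_one_iff`). -/
theorem splitWeilAlgebraic_of_splitWeilAlg
    (h : SplitWeilAlg (bcAct C.act) (fun a b c d => cup4C a b c d)
      (· ∈ (ratC : Submodule ℚ (HC C.B.X (2 * 2)))) ((coniveau C.B.X (2 * 2) 2).baseChange ℂ)) :
    SplitWeilAlgebraic C := by
  intro q hq
  have hw : (1 : ℂ) ⊗ₜ[ℚ] q ∈ weilSpan (bcAct C.act) (fun a b c d => cup4C a b c d) := hq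
  exact (mem_baseChange_mk_one_iff _ q).1 (h _ ⟨q, rfl⟩ hw)

/-- THE DICTIONARY OF THE (S4) OBJECT (`T6A1Dict.H1Ident`) from the factors, with the Hodge-typed `φ₁`:
Lange's `e : ⋀⁴ H¹ ≃ H⁴` on `cup4C` (t6-p2's Lange all-degrees at `n = 4`, a binder) and the degree-4
rationality clause `h4` (the rational classes of `ℂ ⊗ H⁴(B, ℚ)` are `ℚ`-combinations of four-fold cups of
rational classes of `H¹` — Lange over `ℤ`, a binder). -/
def hostIdentW (hT : ∀ (i : Fin 4) (σ : K →+* ℂ), σ ∈ C.F.T i ↔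
      eigC (C.A i).act σ ≤ hodgeHC Bd (C.A i).smooth 1 1 0)
    (hcA : ∀ i, IsCompl (hodgeHC Bd (C.A i).smooth 1 1 0) (hodgeHC Bd (C.A i).smooth 1 0 1))
    (hcB : IsCompl (hodgeHC Bd C.smooth 1 1 0) (hodgeHC Bd C.smooth 1 0 1)) (h17 : Lemma1117Q)
    (e : ⋀[ℂ]^4 (HC C.B.X 1) ≃ₗ[ℂ] HC C.B.X (2 * 2))
    (he : ∀ v : Fin 4 → HC C.B.X 1, e (exteriorPower.ιMulti ℂ 4 v) = cup4C (v 0) (v 1) (v 2) (v 3))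
    (h4 : ∀ c : HC C.B.X (2 * 2), c ∈ (ratC : Submodule ℚ (HC C.B.X (2 * 2))) →
      ∃ (n : ℕ) (q : Fin n → ℚ) (r : Fin n → Fin 4 → HC C.B.X 1),
        (∀ i j, r i j ∈ (ratC : Submodule ℚ (HC C.B.X 1))) ∧
          c = ∑ i, (q i : ℂ) • cup4C (r i 0) (r i 1) (r i 2) (r i 3)) :
    H1Ident K (HC C.B.X 1) (HC C.B.X (2 * 2)) (bcAct C.act) (fun a b c d => cup4C a b c d)
      (· ∈ (ratC : Submodule ℚ (HC C.B.X (2 * 2)))) :=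
  (factorIdentHC Bd C hT hcA hcB h17).identOfFactors C.F.deg6 e he h4

/-- THE A1 SIDE OF THE HOST COMPOSITE on the (S4) object: `Hyp.PeriodN D → SplitWeilAlgebraic C` for a
transfer shadow `D` of the face whose `D.Alg 2` goes to the base change of the host's `coniveau C.B.X 4 2`
under `(hostIdentW …).φ₄` (`T6A1Dict.splitWeilAlg_of_weilClassesAlgebraic` + `T6TheoremA.theoremA_of_N`). -/
theorem splitWeilAlgebraic_of_periodN [IsGalois ℚ K]
    (hT : ∀ (i : Fin 4) (σ : K →+* ℂ), σ ∈ C.F.T i ↔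
      eigC (C.A i).act σ ≤ hodgeHC Bd (C.A i).smooth 1 1 0)
    (hcA : ∀ i, IsCompl (hodgeHC Bd (C.A i).smooth 1 1 0) (hodgeHC Bd (C.A i).smooth 1 0 1))
    (hcB : IsCompl (hodgeHC Bd C.smooth 1 1 0) (hodgeHC Bd C.smooth 1 0 1)) (h17 : Lemma1117Q)
    (e : ⋀[ℂ]^4 (HC C.B.X 1) ≃ₗ[ℂ] HC C.B.X (2 * 2))
    (he : ∀ v : Fin 4 → HC C.B.X 1, e (exteriorPower.ιMulti ℂ 4 v) = cup4C (v 0) (v 1) (v 2) (v 3))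
    (h4 : ∀ c : HC C.B.X (2 * 2), c ∈ (ratC : Submodule ℚ (HC C.B.X (2 * 2))) →
      ∃ (n : ℕ) (q : Fin n → ℚ) (r : Fin n → Fin 4 → HC C.B.X 1),
        (∀ i j, r i j ∈ (ratC : Submodule ℚ (HC C.B.X 1))) ∧
          c = ∑ i, (q i : ℂ) • cup4C (r i 0) (r i 1) (r i 2) (r i 3))
    (D : TransferShadow C.F)
    (halg : ∀ y ∈ D.Alg 2, (hostIdentW Bd C hT hcA hcB h17 e he h4).φ₄ (extC K y) ∈
      (coniveau C.B.X (2 * 2) 2).baseChange ℂ)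
    (hN : Hyp.PeriodN D) : SplitWeilAlgebraic C :=
  splitWeilAlgebraic_of_splitWeilAlg C
    ((hostIdentW Bd C hT hcA hcB h17 e he h4).splitWeilAlg_of_weilClassesAlgebraic D _ halg
      (theoremA_of_N D hN))

end transport

/-! ## 7. The clause-(b) bridge: Lefschetz (1,1) in the `Bd`-vocabulary gives the `hLef` binder -/

section bridge

variable {K : Type} [Field K] [NumberField K] [NumberField.IsCMField K] (Bd : BettiHodgeData ℂ)
  (C : CornerProduct K)

/-- The shape of t6-p2's Lefschetz (1,1) display in the `Bd`-vocabulary (the lead's l. 10912 (2)(iii)):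
the rational `(1,1)`-classes of `H²` are algebraic classes of `Bd.W`. A hypothesis type here, not a display. -/
abbrev Lefschetz11Shape : Prop :=
  ∀ ⦃n : ℕ⦄ ⦃X : SchemeOver ℂ⦄ (hX : IsSmoothProjective n X),
    (Bd.hodge hX 2).hodgeClasses 1 ≤ Bd.W.algebraicClasses X 1

/-- Clause (b) of the lead's `T6HostBetti` (`BettiClausesAlg`), restated here as a hypothesis type: the
algebraic classes of `Bd.W` are the host's `coniveau` classes, pulled back along `isoObj`. -/
abbrev ClauseB : Prop :=
  ∀ ⦃n : ℕ⦄ ⦃X : SchemeOver ℂ⦄ (_hX : IsSmoothProjective n X) (p : ℕ),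
    Bd.W.algebraicClasses X p = (coniveau X (2 * p) p).comap (Bd.isoObj X (2 * p)).toLinearMap

/-- THE BRIDGE: Lefschetz (1,1) in the `Bd`-vocabulary + clause (b) give the `HC`-shaped `hLef` binder of
`alg_lefschetz_HC` (a rational class `1 ⊗ q` of `ℂ ⊗ H²(B, ℚ)` in the transported `(1,1)`-piece is `1 ⊗ v`
with `v` a rational `(1,1)`-class of `Bd.W`, hence algebraic, hence `q` of coniveau `≥ 1`). -/
theorem hLef_of_lefschetz11 (hL : Lefschetz11Shape Bd) (hb : ClauseB Bd) :
    ∀ c : HC C.B.X 2, c ∈ (ratC : Submodule ℚ (HC C.B.X 2)) → c ∈ hodgeHC Bd C.smooth 2 1 1 →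
      c ∈ (coniveau C.B.X 2 1).baseChange ℂ := by
  rintro _ ⟨q, rfl⟩ hc
  rw [TensorProduct.mk_apply] at hc ⊢
  obtain ⟨w, hw, hwq⟩ := Submodule.mem_map.1 hc
  have hw' : w = (1 : ℂ) ⊗ₜ[ℚ] (Bd.isoObj C.B.X 2).symm q := by
    apply (isoC Bd C.B.X 2).injective
    rw [LinearEquiv.coe_coe] at hwq
    rw [hwq, LinearEquiv.baseChange_tmul, LinearEquiv.apply_symm_apply]
  subst hw'
  have h1 : (Bd.isoObj C.B.X 2).symm q ∈ (Bd.hodge C.smooth 2).hodgeClasses 1 := by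
    rw [HodgeStructure.mem_hodgeClasses_iff]
    exact HodgeStructure.piece_le_F _ 1 1 hw
  have h2 := hL C.smooth h1
  rw [hb C.smooth 1] at h2
  have h3 : (Bd.isoObj C.B.X 2) ((Bd.isoObj C.B.X 2).symm q) ∈ coniveau C.B.X 2 1 := Submodule.mem_comap.1 h2
  rw [LinearEquiv.apply_symm_apply] at h3
  exact (mem_baseChange_mk_one_iff _ q).2 h3

end bridge

end Summit.Ventures.HodgeRepro2.T6.A1HostBetti

end
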